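import Summits.FinalStateConjecture.FinalStateConjecture.Theses.BartnikGapSettling

/-!
# Route BartnikGapSettling · item `Assembly` (stmt-FinalStateConjecture-17714), T2 form

The assembly item of route `BartnikGapSettling` in its current (rev 6, crux-only, T2) form reads
`BondiBartnikRigidity → GapExhaustion → SettledCapture → TameCensorshipCollarMargin → MGHDExists →
FinalStateConjecture`, which is literally the type of the route file's sorry-free deciding theorem
`Summit.FinalStateConjecture.FinalStateConjecture.Theses.BartnikGapSettling.closes` (tame
Christodoulou genericity is monotone under pointwise implication on the admissible class; pointwise,
`MGHDExists` gives the development, `TameCensorshipCollarMargin` complete `𝓘⁺` and the collar margin,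
`GapExhaustion` late bounded-geometry leaves, `BondiBartnikRigidity` near-Kerr leaves to their causal
future, and `SettledCapture` the re-typed final-state conclusion). Pure logic: the proof IS `closes`.

This supersedes `Theorems/BartnikGapSettlingAssembly.lean`, which proved the route's rev-2 assembly
(stmt-FinalStateConjecture-10811: six binders, topology-free `IsChristodoulouGeneric`) with the item
bodies inlined and no longer elaborates against the T2 summit statement (2026-08-16 re-type to
`IsTameChristodoulouGeneric`); the old inlining was only needed while the gate appended
`Assembly_holds` links to route files (import cycle), which it no longer does.

References: Christodoulou, CQG 16 (1999) A23, p. A24; Dafermos–Luk, arXiv:1710.01722, §1.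
-/

-- `Summit.FinalStateConjecture.FinalStateConjecture.…` is the tree's mandated namespace (summit = sub-problem).
set_option linter.dupNamespace false

namespace Summit.FinalStateConjecture.FinalStateConjecture.Theorems

/-- **Item `Assembly` (stmt-FinalStateConjecture-17714), route BartnikGapSettling.**
`BondiBartnikRigidity → GapExhaustion → SettledCapture → TameCensorshipCollarMargin → MGHDExists →
FinalStateConjecture`: after unfolding the route decl this is exactly the route's deciding theorem
`Theses.BartnikGapSettling.closes` (antitone-genericity transfer, tame form). Pure logic; closes the
assembly item. -/
theorem BartnikGapSettling.assemblyT2_proof :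
    Summit.FinalStateConjecture.FinalStateConjecture.Theses.BartnikGapSettling.Assembly := by
  unfold Summit.FinalStateConjecture.FinalStateConjecture.Theses.BartnikGapSettling.Assembly
  exact Summit.FinalStateConjecture.FinalStateConjecture.Theses.BartnikGapSettling.closes

end Summit.FinalStateConjecture.FinalStateConjecture.Theorems
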